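import Summits.HodgeConjecture.HodgeConjecture.Theses.LimitExtension

/-!
# Route LimitExtension — `HypersurfacesSufficeOfLE` (item stmt-HodgeConjecture-10867): the glue, modulo its two registered deps

The support item `HypersurfacesSufficeOfLE` of route `LimitExtension` is
`HodgeModels (inline) → LimitExtensionMid → [cycle part of HC for smooth hypersurfaces] →
[cycle part of HC for all smooth projective varieties]` (the last two brackets are, verbatim, the
antecedent and the conclusion of FiniteTreeOfFlavours' bridge `HypersurfacesSuffice`).  The planner's
proof is "PullbackGlue restricted to cycle parts + MiddleDivisorSupportSuffices"
([deps: PullbackGlue, MiddleDivisorSupportSuffices]); both deps are registered statement items of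
this route (stmt-HodgeConjecture-2999, itself resting on the specialisation lemma
`SpecialisationOfAlgebraicity` = stmt-HodgeConjecture-2998, and stmt-HodgeConjecture-10865, the
Thomas 2005 Prop. 2 / de Cataldo–Migliorini 2009 §4 induction on the dimension).  This file proves,
sorry-free and with no Literature named fact in its cone:

* `limitExtension_pullbackGlue_of_specialisation` — `SpecialisationOfAlgebraicity → PullbackGlue`
  (item stmt-HodgeConjecture-2999 given its one dep: take the limit-extension family of a middle
  class `c`; on every smooth hypersurface fibre `W_t`, `t ≠ t₀`, the restriction `B|_{W_t}` is
  rational — pull-backs of rational classes are rational — and of type `(p,p)`, hence algebraic by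
  `HypersurfaceHodge`; the specialisation lemma gives `(g ≫ ι_{t₀})^* B ∈ N¹`, and
  `c = (c - (g ≫ ι_{t₀})^* B) + (g ≫ ι_{t₀})^* B` with the first summand in `N¹` by the family's
  last clause);
* `limitExtension_hypersurfacesSufficeOfLE_of` — `PullbackGlue → MiddleDivisorSupportSuffices →
  HypersurfacesSufficeOfLE` (the planner's composition: Hodge models + the cycle part of HC on smooth
  hypersurfaces is `HypersurfaceHodge`, since `HodgeConjectureFor n X = Nonempty (HodgeModel n X) ∧
  cycle part` and a smooth hypersurface is smooth projective; `PullbackGlue` turns it into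
  `MiddleDivisorSupport`, `MiddleDivisorSupportSuffices` into `HodgeConjecture`, whose cycle conjunct
  is the claim);
* `limitExtension_hypersurfacesSufficeOfLE_of_specialisation` —
  `SpecialisationOfAlgebraicity → MiddleDivisorSupportSuffices → HypersurfacesSufficeOfLE`.

Why not unconditionally (diagnosis, 2026-08-16).  The tree already PROVES the reduction of HC to
middle-degree classes on even-dimensional varieties (`middleDimensionReduction_holds`, BFNP 2009
Lemma 48, by products with projective spaces — it goes UP in dimension) and proves the descent of
`N¹`-supported Hodge classes to resolved divisors given HC in lower dimension
(`supportedHodgeClassDescent_of`, modulo Deligne III 8.2.8 / Voisin 2025 Cor. 2.12 / Gysin supports /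
Poincaré duality as named facts).  Chaining LE + hypersurface HC + specialisation + descent at an
even dimension `2m` asks for HC on the divisors `Ỹ_j^{2m-1}` in codimension `m - 1` (one below the
middle), which BFNP sends back to the middle degree of the `2m`-fold `Ỹ_j × ℙ¹` — on classes
`s_* b` already supported on the smooth divisor `Ỹ_j × {t}`, where descent returns `b` itself: a
cycle with no decreasing measure.  The step that goes DOWN in dimension (Thomas's Lefschetz-pencil /
relative-Hilbert-scheme argument below the middle, NodalSupport's `PencilReduction`) is exactly the
content of `MiddleDivisorSupportSuffices` that the tree does not have (no Bertini, no weak Lefschetz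
for pencils); `SpecialisationOfAlgebraicity` is the other honest gap.  Hence the item is closed here
modulo precisely its two registered deps, as the route intends.
-/

-- `Summit.HodgeConjecture.HodgeConjecture.Theorems` is the mandated namespace (single-problem summit:
-- Problem = Summit), which `linter.dupNamespace` flags on every declaration; the lakefile turns the
-- linter off for the Summits library (weak option), restated here so stand-alone elaboration is warning-free.
set_option linter.dupNamespace false

noncomputable section

namespace Summit.HodgeConjecture.HodgeConjecture.Theorems

open Summit.HodgeConjecture.HodgeConjecture.Theses.LimitExtension
open Literature.AlgebraicGeometry Literature.AlgebraicGeometry.HodgeTheory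
  Literature.AlgebraicGeometry.Motives CategoryTheory

/-- **`SpecialisationOfAlgebraicity → PullbackGlue`** (item stmt-HodgeConjecture-2999 given its
dep stmt-HodgeConjecture-2998).  Given `LimitExtensionMid` and `HypersurfaceHodge`, every rational
middle `(p,p)`-class `c` on a smooth projective `2p`-fold `X` (`1 ≤ p`) is supported on a divisor:
take the limit-extension family `(T, W, f, t₀, g, B)` of `c`; for `t ≠ t₀` the fibre `W_t` is a
smooth hypersurface of dimension `2p` (in particular smooth projective), `B|_{W_t}` is rational
(pull-backs of rational classes are rational, Hatcher §3.1, the tree's `IsRationalClass.pullback`)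
and of type `(p,p)`, hence algebraic by `HypersurfaceHodge`; the specialisation lemma gives
`(g ≫ ι_{t₀})^* B ∈ N¹H^{2p}(X(ℂ); ℂ) = supportedClasses X (2p) 1`, and
`c = (c - (g ≫ ι_{t₀})^* B) + (g ≫ ι_{t₀})^* B` with the first summand in `N¹` by the family's last
clause (`N¹` is a submodule). [cite: Thomas2005Nodes, Prop. 2] [cite: HatcherAT2002, §3.1] -/
theorem limitExtension_pullbackGlue_of_specialisation (hS : SpecialisationOfAlgebraicity) :
    PullbackGlue := by
  intro hLE hHH p X hp hX c hc hpp
  obtain ⟨T, W, f, t₀, g, B, hT, hirr, hflat, hprop, hU, hB, hfib, hdiff⟩ := hLE hp hX c hc hpp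
  have hspec : complexBetti.map (g ≫ fiberι f t₀) (2 * p) B ∈ supportedClasses X (2 * p) 1 := by
    refine hS f t₀ g B hp hX hT hirr hflat hprop hU fun t ht ↦ ?_
    obtain ⟨⟨d, hhyp⟩, htype⟩ := hfib t ht
    exact ⟨hhyp.1, (hHH hhyp).2 p _ (hB.pullback _) htype⟩
  have hsum : c = (c - complexBetti.map (g ≫ fiberι f t₀) (2 * p) B) +
      complexBetti.map (g ≫ fiberι f t₀) (2 * p) B := (sub_add_cancel c _).symm
  rw [hsum]
  exact Submodule.add_mem _ hdiff hspec

/-- **`PullbackGlue → MiddleDivisorSupportSuffices → HypersurfacesSufficeOfLE`** (the planner's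
composition for item stmt-HodgeConjecture-10867, [deps: PullbackGlue, MiddleDivisorSupportSuffices]).
Given Hodge models `hM`, the limit extension `hLE` and the cycle part of HC on smooth hypersurfaces
`hHyp`: `HypersurfaceHodge` holds (`HodgeConjectureFor n X` is `Nonempty (HodgeModel n X) ∧` the
cycle statement, Deligne 2000 §1 as rendered in `HodgeTheory/HodgeConjecture`, and
`IsSmoothHypersurface n d X` has `IsSmoothProjective n X` as first conjunct), `PullbackGlue` turns
it into `MiddleDivisorSupport`, `MiddleDivisorSupportSuffices hM` into `HodgeConjecture`, and the
cycle conjunct of `HodgeConjectureFor n X` is the claim. [cite: Thomas2005Nodes, Prop. 2]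
[cite: Deligne2000, §1] -/
theorem limitExtension_hypersurfacesSufficeOfLE_of (h₇ : PullbackGlue)
    (h₈ : MiddleDivisorSupportSuffices) : HypersurfacesSufficeOfLE := by
  intro hM hLE hHyp n X hX k c hc hkk
  have hHH : HypersurfaceHodge := fun n d X h ↦ ⟨hM h.1, fun k c hc hkk ↦ hHyp h k c hc hkk⟩
  exact (h₈ hM (h₇ hLE hHH) hX).2 k c hc hkk

/-- **`SpecialisationOfAlgebraicity → MiddleDivisorSupportSuffices → HypersurfacesSufficeOfLE`**:
item stmt-HodgeConjecture-10867 modulo the specialisation lemma (stmt-HodgeConjecture-2998) and the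
induction on dimension (stmt-HodgeConjecture-10865), by
`limitExtension_pullbackGlue_of_specialisation` and `limitExtension_hypersurfacesSufficeOfLE_of`.
[cite: Thomas2005Nodes, Prop. 2] -/
theorem limitExtension_hypersurfacesSufficeOfLE_of_specialisation (h₆ : SpecialisationOfAlgebraicity)
    (h₈ : MiddleDivisorSupportSuffices) : HypersurfacesSufficeOfLE :=
  limitExtension_hypersurfacesSufficeOfLE_of (limitExtension_pullbackGlue_of_specialisation h₆) h₈

end Summit.HodgeConjecture.HodgeConjecture.Theorems

end
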